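import Literature.Analysis.FluidPDE.NSCriticalClosureBesovLeaves
import Literature.Analysis.FluidPDE.NSBoundedMildAnalytic
import HarnessLib

/-!
# The critical Besov continuation criterion: Tao's local theory discharged, and the analytic
# local theory of Oseen's scheme as an alternative to KNSS's

Analysis/FluidPDE assembly file (proofs only, no definitions, no named facts) for the named fact
`Literature.Analysis.FluidPDE.hasSmoothExtensionPast_of_eHomBesovNorm_bounded`
(`NSCriticalClosure.lean`; Gallagher–Koch–Planchon 2016, Thm. 1, contrapositive for classical
Leray–Hopf solutions: a smooth solution on `[0, T)` whose critical Besov norm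
`‖u(t)‖_{Ḃ^{-1+3/r}_{r,q}}`, `3 < r, q < ∞`, stays bounded extends smoothly past `T`).

## State of the dependency before this file

`NSCriticalClosureBesovRecord.lean` / `NSCriticalClosureBesovExponent.lean` record the fact as
the implication from three named facts — (G) GKP's Theorem 1 `gkp_besov_blowup` (or Albritton's
Thm. 1.1 through `gkp_besov_blowup_of_albritton`), (T) Tao's smooth `H¹` local theory
`tao2011_smooth_local_existence` (Tao 2013, Thm. 5.4 (ii)+(iv)) and (L) the KNSS local smoothing
theory `knss2009_local_smoothing ℝ³` (KNSS 2009, Prop. 4.1, short-time quantitative form) — the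
last entering only through `knss_classical_of_bounded_isBesovMildSolutionOn_of_local`
(`NSBoundedMildOseenAssembly.lean`), i.e. through the reduction
`knss_classical_of_bounded_isBesovMildSolutionOn_of_oseen` (`NSBoundedMildOseen.lean`) of the
bounded smoothing step to the four Oseen-architecture facts (A) (proved), (R) (proved),
(P) `knss2009_smoothing ℝ³` (reduced to (L) by `knss2009_smoothing_of_local`) and (C) (proved).

## What this file proves

1. **(T) is discharged.** `tao2011_smooth_local_existence_holds`
   (`CheskidovShvydkoyRegularProofs.lean`, from `tao2011_fourier_local_existence_holds` and
   `sobolev_fourierDatum_of_smooth_holds`) closes the Tao leaf; the records with (L),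
   `hasSmoothExtensionPast_of_eHomBesovNorm_bounded_of_gkp_knssLocal : gkp_besov_blowup →
   knss2009_local_smoothing ℝ³ → _`, are `NSCriticalClosureBesovLeaves.lean` (imported); this file
   adds the Albritton variant and the analytic ones below.

2. **The smoothing input of the Oseen reduction is used only through joint smoothness.** The
   proof of `knss_classical_of_bounded_isBesovMildSolutionOn_of_oseen` invokes (P) only for its
   first clause (the canonical representative `e^{ν(t-s)Δ}a - B^ν_s(u,u)(t)` of a bounded
   solution of the Oseen integral equation is jointly `C^∞` on `(s, T₁) × ℝ³`); the weighted
   bounds `(t-s)^{k/2+l}‖∇ᵏₓ∂ₜˡw‖ ≤ C` of KNSS Prop. 4.1 are never used on this route. We record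
   this as `knss_classical_of_bounded_isBesovMildSolutionOn_of_oseen_smoothRep` (the same proof,
   with the smoothness clause alone as hypothesis; `_of_oseen` is the special case in which the
   clause is read off (P), `fun … => (hP …).1`).

3. **The smoothness clause follows from the local analyticity of Oseen's scheme.** The tree's
   second local theory, `lemarieRieusset2016_local_analyticity` (`NSBoundedMildAnalytic.lean`;
   Lemarié-Rieusset 2016, Thm. 9.12, proof pp. 260–263, after Cannon–Knightly: the fixed point of
   Oseen's `L^∞` scheme from a datum bounded by `M` is jointly real-analytic on
   `(s, s + εν/M²) × ℝ³`, solves the integral equation pointwise and is bounded by `CM`), gives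
   the smoothness clause of (P) by the covering argument of KNSS 2009, §4 / Lemarié-Rieusset
   p. 263 ("`u` has a holomorphic extension to `⋃_{t₀} t₀ + Ω_{γ,M₀}`"), exactly as
   `knss2009_smoothing_of_local` does for (L): near the initial time the local analytic solution
   from `a` at `s` *is* the canonical representative (uniqueness of essentially bounded solutions,
   `oseenMild_essBounded_unique`, and `B^ν_s` only sees a.e. classes of slices:
   `rep_eq_of_continuousOn_localSolution`); away from it one restarts at `s' = t - h/2` from the
   continuous bounded slice `w(s')` ((R), `restart_of_oseenMild_restart`, discharged by
   `oseenMild_restart_holds`) and argues likewise; real-analytic maps are `C^∞`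
   (`AnalyticOnNhd.contDiffOn_of_completeSpace`). This is `smoothRep_of_local_analyticity`, whence
   `knss_classical_of_bounded_isBesovMildSolutionOn_of_local_analyticity :
   lemarieRieusset2016_local_analyticity → knss_classical_of_bounded_isBesovMildSolutionOn`.

4. **Records.** `hasSmoothExtensionPast_of_eHomBesovNorm_bounded` follows from (G) and EITHER
   local theory: `…_of_gkp_knssLocal` (Leaves file) / `…_of_gkp_analytic`, from Albritton's
   Thm. 1.1 (`…_of_albritton_knssLocal`, `…_of_albritton_analytic`), and the disjunction
   `…_of_gkp_local_or_analytic`. (Two former variants were dropped on review, D-0026: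
   `…_of_albrittonFacts_analytic` from the "two halves" of Albritton's Thm. 1.1, when the named
   fact `albritton_regular_of_liminf_besov` — §3, Steps 1–3 of the proof of Thm. 1.1 — was retired
   as a slice of the parent's proof and a corollary of `albritton_besov_blowup`; and
   `…_of_gkpProps3_analytic` from GKP Props. 2.1–2.3 through the exponent-class assembly
   `…_of_gkpExponent_knss`, when the tree-class rendering `gkp_rigidity` of Prop. 2.3 was merged
   back into the proof obligation of GKP Thm. 1 (2026-08-15: mis-stated over the tree's class,
   Step 3 of the printed proof by contradiction, and a corollary of `gkp_besov_blowup`,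
   `gkp_rigidity_of_gkp_besov_blowup`) — a record through Prop. 2.3 is then no longer a record on
   named facts; it was a one-line composition of `…_of_gkpExponent_knss` with
   `limsup_eq_top_of_isGKPExponent`, which keeps the statement of Prop. 2.3 as an explicit
   hypothesis.)

After this file the trust base of the fact is: one of {`gkp_besov_blowup`,
`albritton_besov_blowup`} together with one of
{`knss2009_local_smoothing ℝ³`, `lemarieRieusset2016_local_analyticity`}. Nothing is defined and no
statement of the tree is changed.

## Mathlib / tree search

Tree (`lean search '_holds' --decl`, 2026-08-15): `tao2011_smooth_local_existence_holds`,
`tao2011_hasBoundedSobolevNormsOn_holds`, `tao2011_isMildNSSolutionOn_of_memSobolevX_holds`,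
`oseenMild_of_bounded_isBesovMildSolutionOn_holds`, `oseenMild_restart_holds`,
`classical_of_smooth_isMildNSSolutionOn_holds` present; no `_holds` for `gkp_besov_blowup`,
`albritton_besov_blowup`, `knss2009_local_smoothing`, `lemarieRieusset2016_local_analyticity`.
Reused: `restart_of_oseenMild_restart`, `continuous_oseenDuhamel_slice`,
`norm_le_of_continuous_of_ae_eq` (`NSBoundedMildSmoothing`); `oseenMild_essBounded_unique`
(`OseenMildUniqueness`); `oseenDuhamel_congr_ae_slice` (`NSBoundedMildOseenDuhamel`);
`heatExtension_congr_ae` (`MildL3Smooth`); `continuous_radialRetract`, `radialRetract_eq_self`,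
`norm_radialRetract_le` (`BoundedRepresentative`); `IsMildNSSolutionOn.congr_ae_Ioo`
(`NSBoundedMildOseen`); `eq_of_ae_eq_of_continuous` (`NSCriticalClosureTao`). Mathlib:
`AnalyticOnNhd.contDiffOn_of_completeSpace`, `AnalyticOnNhd.continuousOn`,
`contDiffOn_of_locally_contDiffOn`, `contDiffOn_infty`, `Continuous.ae_eq_iff_eq`.

## References

* I. Gallagher, G. S. Koch, F. Planchon, *Blow-up of critical Besov norms at a potential
  Navier–Stokes singularity*, Comm. Math. Phys. 343 (2016) 39–82 = arXiv:1407.4156, Thm. 1 (p. 5)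
  and §2.1 (p. 6). [GKP2016]
* P. G. Lemarié-Rieusset, *The Navier–Stokes Problem in the 21st Century*, CRC Press 2016,
  doi:10.1201/b19556, Thm. 9.12 and its proof, PDF pp. 260–263. [LemarieRieusset2016]
* G. Koch, N. Nadirashvili, G. Seregin, V. Šverák, *Liouville theorems for the Navier–Stokes
  equations and applications*, Acta Math. 203 (2009) 83–105 = arXiv:0709.3599, §4, Prop. 4.1
  (p. 8). [KochNadirashviliSereginSverak2009]
* T. Tao, *Localisation and compactness properties of the Navier–Stokes global regularity
  problem*, Anal. PDE 6 (2013) 25–107, Thm. 5.4. [Tao2011]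
* D. Albritton, *Blow-up criteria for the Navier–Stokes equations in non-endpoint critical Besov
  spaces*, Anal. PDE 11 (2018) 1415–1456, Thm. 1.1, Cor. 4.6. [Albritton2018]
-/

noncomputable section

open MeasureTheory TemperedDistribution Set Function Filter
open _root_.Topology
open scoped SchwartzMap ENNReal NNReal RealInnerProductSpace

namespace Literature.Analysis.FluidPDE

/-! ### The window lemma: a continuous local solution is the canonical representative -/

section Window

variable {E : Type*} [NormedAddCommGroup E] [InnerProductSpace ℝ E] [FiniteDimensional ℝ E]
  [MeasurableSpace E] [BorelSpace E]

/-- **A continuous bounded local solution represents every bounded solution on its window.**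
Let `v` be continuous on `(s', s' + h) × E`, bounded by `K`, and solve
`v(t) = e^{ν(t-s')Δ}a' - B^ν_{s'}(v,v)(t)` pointwise there; let `u` be jointly measurable on
`(s', T₁) × E` with slices essentially bounded by `Mp` and solve the same equation a.e. for
every `t ∈ (s', T₁)`. Then `u(t) = v(t)` a.e. for `t ∈ (s', min(s' + h, T₁))` (uniqueness of
essentially bounded solutions of the Oseen integral equation, `oseenMild_essBounded_unique`;
KNSS 2009, Lemma 3.1 / §4, Lemarié-Rieusset 2016, proof of Thm. 9.12, p. 260: on its window the
bounded mild solution "is given by" the local one), and the canonical representative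
`e^{ν(t-s')Δ}a' - B^ν_{s'}(u,u)(t)` *is* `v(t)` there, pointwise (the Duhamel term only sees the
a.e. classes of the slices, `oseenDuhamel_congr_ae_slice`). The continuity/analyticity-agnostic
core of `exists_local_smooth_representative`. [cite: KochNadirashviliSereginSverak2009, §4 with Lemma 3.1 (arXiv:0709.3599 pp. 7–8)] -/
theorem rep_eq_of_continuousOn_localSolution {ν s' T₁ h Mp K : ℝ} {a' : E → E}
    {u v : ℝ → E → E} (hν : 0 < ν) (hMp : 0 ≤ Mp) (hK : 0 ≤ K)
    (hvc : ContinuousOn (uncurry v) (Ioo s' (s' + h) ×ˢ univ))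
    (hveq : ∀ t ∈ Ioo s' (s' + h), ∀ x,
      v t x = UnboundedOperators.heatExtension a' (ν * (t - s')) x - oseenDuhamel ν s' v v t x)
    (hvK : ∀ t ∈ Ioo s' (s' + h), ∀ x, ‖v t x‖ ≤ K)
    (hum : AEStronglyMeasurable (uncurry u)
      ((volume : Measure (ℝ × E)).restrict (Ioo s' T₁ ×ˢ univ)))
    (huM : ∀ t ∈ Ioo s' T₁, eLpNorm (u t) ∞ volume ≤ ENNReal.ofReal Mp)
    (husol : ∀ t ∈ Ioo s' T₁, u t =ᵐ[volume] fun x =>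
      UnboundedOperators.heatExtension a' (ν * (t - s')) x - oseenDuhamel ν s' u u t x) :
    (∀ t ∈ Ioo s' (min (s' + h) T₁), u t =ᵐ[volume] v t) ∧
      ∀ t ∈ Ioo s' (min (s' + h) T₁), ∀ x,
        UnboundedOperators.heatExtension a' (ν * (t - s')) x - oseenDuhamel ν s' u u t x = v t x := by
  set T' : ℝ := min (s' + h) T₁ with hT'
  have hT'T₁ : T' ≤ T₁ := min_le_right _ _
  have hT'h : T' ≤ s' + h := min_le_left _ _
  -- uniqueness on `(s', T')`
  have hae : ∀ t ∈ Ioo s' T', u t =ᵐ[volume] v t := by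
    have hsub : Ioo s' T' ×ˢ (univ : Set E) ⊆ Ioo s' T₁ ×ˢ univ :=
      prod_mono (Ioo_subset_Ioo_right hT'T₁) subset_rfl
    have hsub' : Ioo s' T' ×ˢ (univ : Set E) ⊆ Ioo s' (s' + h) ×ˢ univ :=
      prod_mono (Ioo_subset_Ioo_right hT'h) subset_rfl
    have hvm : AEStronglyMeasurable (uncurry v)
        ((volume : Measure (ℝ × E)).restrict (Ioo s' T' ×ˢ univ)) :=
      (hvc.mono hsub').aestronglyMeasurable (measurableSet_Ioo.prod MeasurableSet.univ)
    set M' : ℝ := Mp + K with hM'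
    have hMpM' : ENNReal.ofReal Mp ≤ ENNReal.ofReal M' :=
      ENNReal.ofReal_le_ofReal (by rw [hM']; linarith)
    have hvM' : ∀ t ∈ Ioo s' T', eLpNorm (v t) ∞ volume ≤ ENNReal.ofReal M' := by
      intro t ht
      rw [eLpNorm_exponent_top]
      refine eLpNormEssSup_le_of_ae_bound (Eventually.of_forall fun x => ?_)
      have := hvK t ⟨ht.1, ht.2.trans_le hT'h⟩ x
      rw [hM']; linarith
    have huM' : ∀ t ∈ Ioo s' T', eLpNorm (u t) ∞ volume ≤ ENNReal.ofReal M' :=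
      fun t ht => (huM t ⟨ht.1, ht.2.trans_le hT'T₁⟩).trans hMpM'
    have hvsol : ∀ t ∈ Ioo s' T', v t =ᵐ[volume] fun x =>
        UnboundedOperators.heatExtension a' (ν * (t - s')) x - oseenDuhamel ν s' v v t x :=
      fun t ht => Eventually.of_forall fun x => hveq t ⟨ht.1, ht.2.trans_le hT'h⟩ x
    exact oseenMild_essBounded_unique (U := fun t x =>
        UnboundedOperators.heatExtension a' (ν * (t - s')) x) hν (by rw [hM']; positivity)
      (hum.mono_measure (Measure.restrict_mono hsub le_rfl)) hvm huM' hvM'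
      (fun t ht => husol t ⟨ht.1, ht.2.trans_le hT'T₁⟩) hvsol
  refine ⟨hae, fun t ht x => ?_⟩
  have hB : oseenDuhamel ν s' u u t x = oseenDuhamel ν s' v v t x :=
    oseenDuhamel_congr_ae_slice (fun τ hτ => hae τ ⟨hτ.1, hτ.2.trans ht.2⟩)
      (fun τ hτ => hae τ ⟨hτ.1, hτ.2.trans ht.2⟩) x
  rw [hB, hveq t ⟨ht.1, ht.2.trans_le hT'h⟩ x]

end Window

/-! ### The smoothness clause of (P) from the local analyticity of Oseen's scheme -/

section Analytic

/-- **Joint smoothness of the canonical representative from the local analyticity of Oseen's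
scheme** (Lemarié-Rieusset 2016, Thm. 9.12, proof pp. 260–263: the bounded mild solution is,
on every window `(t₀, t₀ + 1/(4C₀‖u(t₀)‖_∞)²)`, the (analytic) sum of the Oseen series from
`u(t₀)`, and "`u` has a holomorphic extension to `⋃_{t₀} t₀ + Ω_{γ,M₀}`, thus `u` is analytic on
`(T₀, T₁) × ℝ³`", p. 263; the covering is that of KNSS 2009, §4, Prop. 4.1). Let `u` be a
bounded solution of `u(t) = e^{ν(t-s)Δ}a - B^ν_s(u,u)(t)` on `(s, T₁)` from `a ∈ L^∞(ℝ³)`,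
`‖a‖_∞, ‖u(t)‖_∞ ≤ M`, and let `w(t) = e^{ν(t-s)Δ}a - B^ν_s(u,u)(t)` be its canonical
representative. Then `w` is jointly `C^∞` on `(s, T₁) × ℝ³` and `‖w‖ ≤ M` — the first two
clauses of (P) `knss2009_smoothing ℝ³` — granted the restart fact (R) and the local analyticity
fact. Proof: `w(t) = u(t)` a.e. with continuous slices, so `‖w‖ ≤ M`; on `(s, s + h)`,
`h = εν/(M+1)²`, `w` is the local analytic solution from `a` (`rep_eq_of_continuousOn_localSolution`);
for `t ≥ s + h` restart at `s' = t - h/2` from the continuous datum `w(s')` ((R)) and use the local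
analytic solution from `w(s')`, which agrees with `u`, hence with `w`, a.e. and then pointwise
(continuous slices); analytic maps are `C^∞`. [cite: LemarieRieusset2016, Thm. 9.12 (proof, PDF pp. 260–263)] -/
theorem smoothRep_of_local_analyticity (hR : oseenMild_restart (EuclideanSpace ℝ (Fin 3)))
    (hLA : lemarieRieusset2016_local_analyticity) ⦃ν : ℝ⦄ (hν : 0 < ν) ⦃s T₁ : ℝ⦄ (hsT : s < T₁)
    ⦃a : EuclideanSpace ℝ (Fin 3) → EuclideanSpace ℝ (Fin 3)⦄
    ⦃u : ℝ → EuclideanSpace ℝ (Fin 3) → EuclideanSpace ℝ (Fin 3)⦄ ⦃M : ℝ⦄ (hM : 0 ≤ M)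
    (ha : AEStronglyMeasurable a volume) (haM : eLpNorm a ∞ volume ≤ ENNReal.ofReal M)
    (hum : AEStronglyMeasurable (uncurry u)
      ((volume : Measure (ℝ × EuclideanSpace ℝ (Fin 3))).restrict (Ioo s T₁ ×ˢ univ)))
    (huM : ∀ t ∈ Ioo s T₁, eLpNorm (u t) ∞ volume ≤ ENNReal.ofReal M)
    (husol : ∀ t ∈ Ioo s T₁, u t =ᵐ[volume] fun x =>
      UnboundedOperators.heatExtension a (ν * (t - s)) x - oseenDuhamel ν s u u t x) :
    IsSmoothSpaceTimeOn (Ioo s T₁)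
        (fun t x => UnboundedOperators.heatExtension a (ν * (t - s)) x - oseenDuhamel ν s u u t x) ∧
      ∀ t ∈ Ioo s T₁, ∀ x,
        ‖UnboundedOperators.heatExtension a (ν * (t - s)) x - oseenDuhamel ν s u u t x‖ ≤ M := by
  set w : ℝ → EuclideanSpace ℝ (Fin 3) → EuclideanSpace ℝ (Fin 3) := fun t x =>
    UnboundedOperators.heatExtension a (ν * (t - s)) x - oseenDuhamel ν s u u t x with hw
  -- (0) `w(t) = u(t)` a.e.
  have hwu : ∀ t ∈ Ioo s T₁, w t =ᵐ[volume] u t := fun t ht => (husol t ht).symm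
  -- a bounded representative `ub` of `u` (radius `M + 1`), for the continuity of the slices
  have hM1 : 0 < M + 1 := by linarith
  set ρ : EuclideanSpace ℝ (Fin 3) → EuclideanSpace ℝ (Fin 3) :=
    fun z => ((M + 1) / max (M + 1) ‖z‖) • z with hρ
  have hρc : Continuous ρ := continuous_radialRetract hM1
  set ub : ℝ → EuclideanSpace ℝ (Fin 3) → EuclideanSpace ℝ (Fin 3) := fun τ y => ρ (u τ y) with hub
  have hubu : ∀ τ ∈ Ioo s T₁, ub τ =ᵐ[volume] u τ := fun τ hτ => by
    filter_upwards [ae_norm_le_of_eLpNorm_top_le hM (huM τ hτ)] with y hy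
    exact radialRetract_eq_self hM1 (by linarith)
  have hubm : AEStronglyMeasurable (uncurry ub)
      ((volume : Measure (ℝ × EuclideanSpace ℝ (Fin 3))).restrict (Ioo s T₁ ×ˢ univ)) :=
    hρc.comp_aestronglyMeasurable hum
  have hubM : ∀ τ ∈ Ioo s T₁, ∀ y, ‖ub τ y‖ ≤ M + 1 := fun τ _ y => norm_radialRetract_le hM1 _
  have hBub : ∀ t ∈ Ioo s T₁, oseenDuhamel ν s u u t = oseenDuhamel ν s ub ub t := fun t ht => by
    funext x
    exact oseenDuhamel_congr_ae_slice (fun τ hτ => (hubu τ ⟨hτ.1, hτ.2.trans ht.2⟩).symm)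
      (fun τ hτ => (hubu τ ⟨hτ.1, hτ.2.trans ht.2⟩).symm) x
  -- (1) continuity of the slices of `w`
  have haLp : MemLp a ∞ volume := ⟨ha, haM.trans_lt ENNReal.ofReal_lt_top⟩
  have hwcont : ∀ t ∈ Ioo s T₁, Continuous (w t) := by
    intro t ht
    have h1 : Continuous (UnboundedOperators.heatExtension a (ν * (t - s))) :=
      (UnboundedOperators.contDiff_heatExtension_holds haLp le_top
        (mul_pos hν (sub_pos.2 ht.1))).continuous
    have h2 : Continuous (oseenDuhamel ν s ub ub t) :=
      continuous_oseenDuhamel_slice hν hM1.le hubm hubm hubM hubM ht.1 ht.2.le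
    have h3 : w t = fun x =>
        UnboundedOperators.heatExtension a (ν * (t - s)) x - oseenDuhamel ν s ub ub t x := by
      funext x
      simp only [hw, hBub t ht]
    rw [h3]
    exact h1.sub h2
  -- (2) the bound `‖w(t, x)‖ ≤ M`
  have hwM : ∀ t ∈ Ioo s T₁, ∀ x, ‖w t x‖ ≤ M := fun t ht x =>
    norm_le_of_continuous_of_ae_eq hM (hwcont t ht) (hwu t ht) (huM t ht) x
  have hwMp : ∀ t ∈ Ioo s T₁, eLpNorm (w t) ∞ volume ≤ ENNReal.ofReal (M + 1) := fun t ht => by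
    rw [eLpNorm_exponent_top]
    exact eLpNormEssSup_le_of_ae_bound
      (Eventually.of_forall fun x => (hwM t ht x).trans (by linarith))
  have huMp : ∀ t ∈ Ioo s T₁, eLpNorm (u t) ∞ volume ≤ ENNReal.ofReal (M + 1) :=
    fun t ht => (huM t ht).trans (ENNReal.ofReal_le_ofReal (by linarith))
  have haMp : eLpNorm a ∞ volume ≤ ENNReal.ofReal (M + 1) :=
    haM.trans (ENNReal.ofReal_le_ofReal (by linarith))
  -- (3) restart at every `s' ∈ (s, T₁)`, from the continuous datum `w(s')`
  have hrestart : ∀ ⦃s' : ℝ⦄, s < s' → s' < T₁ → ∀ t ∈ Ioo s' T₁, u t =ᵐ[volume] fun x =>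
      UnboundedOperators.heatExtension (w s') (ν * (t - s')) x - oseenDuhamel ν s' u u t x := by
    intro s' hss' hs'T t ht
    have h := restart_of_oseenMild_restart hR hν hsT ha haM hum huM husol hss' ht.1 ht.2
    rw [← heatExtension_congr_ae (hwu s' ⟨hss', hs'T⟩) (ν * (t - s'))] at h
    exact h
  -- (4) the local analytic windows: from `s` (datum `a`) and from `s' ∈ (s, T₁)` (datum `w s'`)
  obtain ⟨ε, hε, C, hC, hLoc⟩ := hLA
  set h : ℝ := ε * ν / (M + 1) ^ 2 with hh
  have hh0 : 0 < h := by positivity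
  have hwin0 : ∃ v : ℝ → EuclideanSpace ℝ (Fin 3) → EuclideanSpace ℝ (Fin 3),
      AnalyticOnNhd ℝ (uncurry v) (Ioo s (s + h) ×ˢ univ) ∧
        ∀ t ∈ Ioo s (min (s + h) T₁), ∀ y, w t y = v t y := by
    obtain ⟨v, hva, hveq, hvM⟩ := hLoc hν s hM1 ha haMp
    exact ⟨v, hva, (rep_eq_of_continuousOn_localSolution hν hM1.le (by positivity)
      hva.continuousOn hveq hvM hum huMp husol).2⟩
  have hwin1 : ∀ ⦃s' : ℝ⦄, s < s' → s' < T₁ →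
      ∃ v : ℝ → EuclideanSpace ℝ (Fin 3) → EuclideanSpace ℝ (Fin 3),
        AnalyticOnNhd ℝ (uncurry v) (Ioo s' (s' + h) ×ˢ univ) ∧
          ∀ t ∈ Ioo s' (min (s' + h) T₁), ∀ y, w t y = v t y := by
    intro s' hss' hs'T
    have hws'm : AEStronglyMeasurable (w s') volume :=
      (hwcont s' ⟨hss', hs'T⟩).aestronglyMeasurable
    have hum' : AEStronglyMeasurable (uncurry u)
        ((volume : Measure (ℝ × EuclideanSpace ℝ (Fin 3))).restrict (Ioo s' T₁ ×ˢ univ)) :=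
      hum.mono_measure (Measure.restrict_mono
        (prod_mono (Ioo_subset_Ioo_left hss'.le) subset_rfl) le_rfl)
    obtain ⟨v, hva, hveq, hvM⟩ := hLoc hν s' hM1 hws'm (hwMp s' ⟨hss', hs'T⟩)
    have hae := (rep_eq_of_continuousOn_localSolution hν hM1.le (by positivity) hva.continuousOn
      hveq hvM hum' (fun t ht => huMp t ⟨hss'.trans ht.1, ht.2⟩) (hrestart hss' hs'T)).1
    refine ⟨v, hva, fun t ht y => ?_⟩
    -- `w t = v t` a.e., and both slices are continuous
    have htT : t ∈ Ioo s T₁ := ⟨hss'.trans ht.1, ht.2.trans_le (min_le_right _ _)⟩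
    have hth : t ∈ Ioo s' (s' + h) := ⟨ht.1, ht.2.trans_le (min_le_left _ _)⟩
    have h1 : w t =ᵐ[volume] v t := (hwu t htT).trans (hae t ht)
    have hvc : Continuous (v t) :=
      hva.continuousOn.comp_continuous (f := fun y : EuclideanSpace ℝ (Fin 3) => (t, y))
        (by fun_prop) (fun y => mk_mem_prod hth (mem_univ y))
    exact congr_fun (((hwcont t htT).ae_eq_iff_eq volume hvc).1 h1) y
  -- (5) the two conclusions
  refine ⟨?_, hwM⟩
  -- joint smoothness: `w` is a real-analytic local solution near every point of the slab
  change ContDiffOn ℝ ((⊤ : ℕ∞) : WithTop ℕ∞) (uncurry w) (Ioo s T₁ ×ˢ univ)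
  refine contDiffOn_of_locally_contDiffOn fun p hp => ?_
  obtain ⟨hpt, -⟩ := mem_prod.1 hp
  -- the window containing `p.1`
  have hcover : ∃ s' : ℝ, s ≤ s' ∧ p.1 ∈ Ioo s' (min (s' + h) T₁) ∧
      ∃ v : ℝ → EuclideanSpace ℝ (Fin 3) → EuclideanSpace ℝ (Fin 3),
        AnalyticOnNhd ℝ (uncurry v) (Ioo s' (s' + h) ×ˢ univ) ∧
          ∀ t ∈ Ioo s' (min (s' + h) T₁), ∀ y, w t y = v t y := by
    by_cases hcase : p.1 < s + h
    · obtain ⟨v, hva, hwv⟩ := hwin0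
      exact ⟨s, le_rfl, ⟨hpt.1, lt_min hcase hpt.2⟩, v, hva, hwv⟩
    · rw [not_lt] at hcase
      have hss' : s < p.1 - h / 2 := by linarith
      have hs'T : p.1 - h / 2 < T₁ := by linarith [hpt.2]
      obtain ⟨v, hva, hwv⟩ := hwin1 hss' hs'T
      exact ⟨p.1 - h / 2, hss'.le, ⟨by linarith, lt_min (by linarith) hpt.2⟩, v, hva, hwv⟩
  obtain ⟨s', hss', hps', v, hva, hwv⟩ := hcover
  refine ⟨Ioo s' (min (s' + h) T₁) ×ˢ univ, isOpen_Ioo.prod isOpen_univ,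
    mk_mem_prod hps' (mem_univ _), ?_⟩
  have hsub : Ioo s T₁ ×ˢ (univ : Set (EuclideanSpace ℝ (Fin 3))) ∩ Ioo s' (min (s' + h) T₁) ×ˢ univ =
      Ioo s' (min (s' + h) T₁) ×ˢ univ := by
    rw [inter_eq_right]
    exact prod_mono (Ioo_subset_Ioo hss' (min_le_right _ _)) subset_rfl
  rw [hsub]
  have hvs' : ContDiffOn ℝ ((⊤ : ℕ∞) : WithTop ℕ∞) (uncurry v) (Ioo s' (min (s' + h) T₁) ×ˢ univ) :=
    (hva.contDiffOn_of_completeSpace).mono (prod_mono (Ioo_subset_Ioo_right (min_le_left (s' + h) T₁))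
      (subset_refl (univ : Set (EuclideanSpace ℝ (Fin 3)))))
  refine hvs'.congr fun q hq => ?_
  obtain ⟨hq1, -⟩ := mem_prod.1 hq
  exact hwv q.1 hq1 q.2

end Analytic

/-! ### The Oseen reduction needs only the smoothness clause of (P) -/

section Oseen

/-- **The bounded smoothing step from (A), (R), the smoothness clause of (P), and (C)** — the
proof of `knss_classical_of_bounded_isBesovMildSolutionOn_of_oseen` (`NSBoundedMildOseen.lean`;
KNSS 2009, §4 with Prop. 4.1; Lemarié-Rieusset 2016, Thm. 6.1; Fabes–Jones–Rivière 1972,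
Thm. 2.1) verbatim, with its smoothing hypothesis (P) `knss2009_smoothing ℝ³` weakened to the only
clause that proof uses: the canonical representative `e^{ν(t-s)Δ}a - B^ν_s(u,u)(t)` of a bounded
solution of the Oseen integral equation on `(s, T₁)` from `a ∈ L^∞` is jointly `C^∞` on
`(s, T₁) × ℝ³`. (By (A) and (R), `u(t) = w_s(t)` a.e. for `0 < s < t < T`; each `w_s` is jointly
smooth; continuous slices a.e. equal to `u(t)` coincide, so `v(t) = w_{t/2}(t)` is jointly smooth
on `(0, T) × ℝ³`, inherits the duality-form identities and the slice bounds from `u`, and (C)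
gives the pressure.) [cite: KochNadirashviliSereginSverak2009, §4 with Prop. 4.1 (arXiv:0709.3599 p. 8)] -/
theorem knss_classical_of_bounded_isBesovMildSolutionOn_of_oseen_smoothRep
    (hA : oseenMild_of_bounded_isBesovMildSolutionOn)
    (hR : oseenMild_restart (EuclideanSpace ℝ (Fin 3)))
    (hP : ∀ ⦃ν : ℝ⦄, 0 < ν → ∀ ⦃s T₁ : ℝ⦄, s < T₁ →
      ∀ ⦃a : EuclideanSpace ℝ (Fin 3) → EuclideanSpace ℝ (Fin 3)⦄
        ⦃u : ℝ → EuclideanSpace ℝ (Fin 3) → EuclideanSpace ℝ (Fin 3)⦄ ⦃M : ℝ⦄, 0 ≤ M →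
        AEStronglyMeasurable a volume → eLpNorm a ∞ volume ≤ ENNReal.ofReal M →
        AEStronglyMeasurable (uncurry u)
          ((volume : Measure (ℝ × EuclideanSpace ℝ (Fin 3))).restrict (Ioo s T₁ ×ˢ univ)) →
        (∀ t ∈ Ioo s T₁, eLpNorm (u t) ∞ volume ≤ ENNReal.ofReal M) →
        (∀ t ∈ Ioo s T₁, u t =ᵐ[volume] fun x =>
          UnboundedOperators.heatExtension a (ν * (t - s)) x - oseenDuhamel ν s u u t x) →
          IsSmoothSpaceTimeOn (Ioo s T₁) fun t x =>
            UnboundedOperators.heatExtension a (ν * (t - s)) x - oseenDuhamel ν s u u t x)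
    (hC : classical_of_smooth_isMildNSSolutionOn (EuclideanSpace ℝ (Fin 3))) :
    knss_classical_of_bounded_isBesovMildSolutionOn := by
  intro ν T hν hT p q _ hp₃ hp hq₁ hq u U hB hbd
  -- (A): the integral equation from the datum, a.e. at every positive time
  have hA' := hA hν hT hp₃ hp hq₁ hq hB hbd
  have hdat : ∀ a : ℝ, 0 < a →
      Integrable (fun y => UnboundedOperators.heatKernel a y * ‖u 0 y‖) volume :=
    fun a ha => (hB.isDistributionOf 0 ⟨le_rfl, hT⟩).integrable_heatKernel_mul_norm ha
  have hmeas : AEStronglyMeasurable (uncurry u) (volume.restrict (Ioo 0 T ×ˢ univ)) :=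
    hB.aestronglyMeasurable
  have hmeas₀ : AEStronglyMeasurable (u 0) volume :=
    (hB.isDistributionOf 0 ⟨le_rfl, hT⟩).aestronglyMeasurable
  -- the datum is bounded by the same constants (Besov continuity at `t = 0`)
  have hbd₀ : ∀ T₁ ∈ Ioo 0 T, ∃ C : ℝ≥0∞, C < ∞ ∧ ∀ t ∈ Ico 0 T₁, eLpNorm (u t) ∞ volume ≤ C := by
    intro T₁ hT₁
    obtain ⟨C, hC, hCb⟩ := hbd T₁ hT₁
    have hs := gkp_index_mem_Ioo hp₃ hp
    have h0 : eLpNorm (u 0) ∞ volume ≤ C :=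
      eLpNorm_top_zero_le_of_continuousInHomBesovOn hs.2 (by linarith [hs.1]) hq₁ hT₁.1 hT₁.2.le
        hB.continuousInHomBesovOn hB.isDistributionOf hC hCb
    refine ⟨C, hC, fun t ht => ?_⟩
    rcases ht.1.eq_or_lt with h | h
    · rw [← h]; exact h0
    · exact hCb t ⟨h, ht.2⟩
  -- (R): restart at every positive time
  have hR' : ∀ ⦃s t : ℝ⦄, 0 < s → s < t → t < T → u t =ᵐ[volume] fun x =>
      UnboundedOperators.heatExtension (u s) (ν * (t - s)) x - oseenDuhamel ν s u u t x :=
    hR hν hT hmeas hmeas₀ hbd₀ hA'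
  -- the smooth representatives `w s` on `(s, T₁) × ℝ³`, by the smoothness clause
  set w : ℝ → ℝ → EuclideanSpace ℝ (Fin 3) → EuclideanSpace ℝ (Fin 3) := fun s t x =>
    UnboundedOperators.heatExtension (u s) (ν * (t - s)) x - oseenDuhamel ν s u u t x with hw
  have hP' : ∀ ⦃s T₁ : ℝ⦄, 0 < s → s < T₁ → T₁ < T → IsSmoothSpaceTimeOn (Ioo s T₁) (w s) := by
    intro s T₁ hs hsT₁ hT₁
    obtain ⟨C, hC, hCb⟩ := hbd T₁ ⟨hs.trans hsT₁, hT₁⟩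
    have hCM : C = ENNReal.ofReal C.toReal := (ENNReal.ofReal_toReal hC.ne).symm
    have ha : eLpNorm (u s) ∞ volume ≤ ENNReal.ofReal C.toReal := hCM ▸ hCb s ⟨hs, hsT₁⟩
    have hb : ∀ t ∈ Ioo s T₁, eLpNorm (u t) ∞ volume ≤ ENNReal.ofReal C.toReal :=
      fun t ht => hCM ▸ hCb t ⟨hs.trans ht.1, ht.2⟩
    have hmeas_s : AEStronglyMeasurable (uncurry u) (volume.restrict (Ioo s T₁ ×ˢ univ)) :=
      hmeas.mono_measure
        (Measure.restrict_mono (prod_mono (Ioo_subset_Ioo hs.le hT₁.le) Subset.rfl) le_rfl)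
    have hsl : AEStronglyMeasurable (u s) volume :=
      (hB.isDistributionOf s ⟨hs.le, hsT₁.trans hT₁⟩).aestronglyMeasurable
    exact hP hν hsT₁ ENNReal.toReal_nonneg hsl ha hmeas_s hb
      (fun t ht => hR' hs ht.1 (ht.2.trans hT₁))
  -- `w s t = u t` a.e., and slices of `w s` are continuous
  have hwu : ∀ ⦃s t : ℝ⦄, 0 < s → s < t → t < T → w s t =ᵐ[volume] u t :=
    fun s t hs hst htT => (hR' hs hst htT).symm
  have hwcont : ∀ ⦃s t : ℝ⦄, 0 < s → s < t → t < T → Continuous (w s t) := by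
    intro s t hs hst htT
    have h1 := hP' hs (show s < (t + T) / 2 by linarith) (by linarith)
    exact (h1.contDiff_slice ⟨hst, by linarith⟩).continuous
  -- any two representatives agree where both are defined
  have hagree : ∀ ⦃s s' t : ℝ⦄, 0 < s → s < t → 0 < s' → s' < t → t < T → w s t = w s' t :=
    fun s s' t hs hst hs' hs't htT =>
      eq_of_ae_eq_of_continuous (hwcont hs hst htT) (hwcont hs' hs't htT)
        ((hwu hs hst htT).trans (hwu hs' hs't htT).symm)
  -- the global representative
  set v : ℝ → EuclideanSpace ℝ (Fin 3) → EuclideanSpace ℝ (Fin 3) := fun t => w (t / 2) t with hv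
  have hvw : ∀ ⦃s t : ℝ⦄, 0 < s → s < t → t < T → v t = w s t := fun s t hs hst htT =>
    hagree (half_pos (hs.trans hst)) (half_lt_self (hs.trans hst)) hs hst htT
  have hvu : ∀ t ∈ Ioo 0 T, v t =ᵐ[volume] u t := fun t ht =>
    hwu (half_pos ht.1) (half_lt_self ht.1) ht.2
  -- `v` is jointly smooth on `(0, T) × ℝ³`
  have hvsmooth : IsSmoothSpaceTimeOn (Ioo 0 T) v := by
    refine contDiffOn_of_locally_contDiffOn fun z hz => ?_
    obtain ⟨ht, -⟩ := mem_prod.1 hz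
    set s : ℝ := z.1 / 2 with hs
    set T₁ : ℝ := (z.1 + T) / 2 with hT₁
    have hs0 : 0 < s := half_pos ht.1
    have hsz : s < z.1 := half_lt_self ht.1
    have hzT₁ : z.1 < T₁ := by rw [hT₁]; linarith [ht.2]
    have hT₁T : T₁ < T := by rw [hT₁]; linarith [ht.2]
    refine ⟨Ioo s T₁ ×ˢ univ, (isOpen_Ioo.prod isOpen_univ), mk_mem_prod ⟨hsz, hzT₁⟩ (mem_univ _),
      ?_⟩
    have hsub : (Ioo 0 T ×ˢ (univ : Set (EuclideanSpace ℝ (Fin 3)))) ∩ Ioo s T₁ ×ˢ univ =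
        Ioo s T₁ ×ˢ univ := by
      rw [inter_eq_right]
      exact prod_mono (Ioo_subset_Ioo hs0.le hT₁T.le) Subset.rfl
    rw [hsub]
    refine (hP' hs0 (hsz.trans hzT₁) hT₁T).congr fun y hy => ?_
    obtain ⟨hy1, -⟩ := mem_prod.1 hy
    change v y.1 y.2 = w s y.1 y.2
    rw [hvw hs0 hy1.1 (hy1.2.trans hT₁T)]
  -- the slice bounds and the duality-form identities transfer to `v`
  have hvbd : ∀ T₁ ∈ Ioo 0 T, ∃ C : ℝ≥0∞, C < ∞ ∧ ∀ t ∈ Ioo 0 T₁, eLpNorm (v t) ∞ volume ≤ C := by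
    intro T₁ hT₁
    obtain ⟨C, hC, hCb⟩ := hbd T₁ hT₁
    refine ⟨C, hC, fun t ht => ?_⟩
    rw [eLpNorm_congr_ae (hvu t ⟨ht.1, ht.2.trans hT₁.2⟩)]
    exact hCb t ht
  have hvmild : FluidPDE.IsMildNSSolutionOn (Ioo 0 T) ν 0 (u 0) v :=
    IsMildNSSolutionOn.congr_ae_Ioo (hB.mild.mono Ioo_subset_Ico_self) hvu
  -- (C): the pressure
  obtain ⟨π, hcl⟩ := hC hν hT hmeas₀ hdat hvsmooth hvbd hvmild
  exact ⟨v, π, hcl, fun t ht => (hvu t ht).symm⟩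

/-- **Classical smoothness of bounded Besov mild solutions from the local analyticity of
Oseen's scheme alone** (Lemarié-Rieusset 2016, Thm. 9.12 with KNSS 2009, §4): with (A), (R),
(C) discharged (`oseenMild_of_bounded_isBesovMildSolutionOn_holds`, `oseenMild_restart_holds`,
`classical_of_smooth_isMildNSSolutionOn_holds`) and the smoothness clause supplied by
`smoothRep_of_local_analyticity`, the fact `knss_classical_of_bounded_isBesovMildSolutionOn`
follows from the single named fact `lemarieRieusset2016_local_analyticity` — a second discharge
path beside `knss_classical_of_bounded_isBesovMildSolutionOn_of_local` ((L)).
[cite: LemarieRieusset2016, Thm. 9.12 (PDF p. 260; proof pp. 260–263)] -/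
theorem knss_classical_of_bounded_isBesovMildSolutionOn_of_local_analyticity
    (hLA : lemarieRieusset2016_local_analyticity) :
    knss_classical_of_bounded_isBesovMildSolutionOn :=
  knss_classical_of_bounded_isBesovMildSolutionOn_of_oseen_smoothRep
    oseenMild_of_bounded_isBesovMildSolutionOn_holds
    (oseenMild_restart_holds (EuclideanSpace ℝ (Fin 3)))
    (fun _ hν _ _ hsT _ _ _ hM ha haM hum huM husol =>
      (smoothRep_of_local_analyticity (oseenMild_restart_holds (EuclideanSpace ℝ (Fin 3))) hLA hν
        hsT hM ha haM hum huM husol).1)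
    (classical_of_smooth_isMildNSSolutionOn_holds (E := EuclideanSpace ℝ (Fin 3)))

end Oseen

/-! ### Records: (G) with either local theory ((T) discharged) -/

section Records

-- `linter.deprecated` is switched off for the next declaration only: it names the deprecated
-- (mis-stated, 2026-08-15) tree-class rendering(s) of GKP Thm. 1 (`gkp_besov_blowup`,
-- `CriticalRegularity.lean`), kept unchanged for their users until the faithful path-space forms
-- are vendored (see those files).
set_option linter.deprecated false in
/-- **The continuation criterion from GKP Thm. 1 and the local analyticity of Oseen's scheme**
(GKP 2016, Thm. 1; Lemarié-Rieusset 2016, Thm. 9.12 for the smoothing of the bounded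
extension): `hasSmoothExtensionPast_of_eHomBesovNorm_bounded_of_gkp_tao_knss` with both Tao facts
discharged and the KNSS smoothing fact supplied by
`knss_classical_of_bounded_isBesovMildSolutionOn_of_local_analyticity`. [cite: GKP2016, Thm. 1] -/
theorem hasSmoothExtensionPast_of_eHomBesovNorm_bounded_of_gkp_analytic (hG : gkp_besov_blowup)
    (hLA : lemarieRieusset2016_local_analyticity) :
    hasSmoothExtensionPast_of_eHomBesovNorm_bounded :=
  hasSmoothExtensionPast_of_eHomBesovNorm_bounded_of_gkp_tao_knss hG
    tao2011_hasBoundedSobolevNormsOn_holds tao2011_smooth_local_existence_holds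
    (knss_classical_of_bounded_isBesovMildSolutionOn_of_local_analyticity hLA)

-- `linter.deprecated` is switched off for the next declaration only: it names the deprecated
-- (mis-stated, 2026-08-15) tree-class rendering(s) of Albritton Thm. 1.1 (`albritton_besov_blowup`,
-- `CriticalRegularity.lean`), kept unchanged for their users until the faithful path-space forms
-- are vendored (see those files).
set_option linter.deprecated false in
/-- **From Albritton's Thm. 1.1 and the local analyticity of Oseen's scheme** (Albritton 2018,
Thm. 1.1 ⟹ GKP Thm. 1, `gkp_besov_blowup_of_albritton`). [cite: Albritton2018, Thm. 1.1] [cite: GKP2016, Thm. 1] -/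
theorem hasSmoothExtensionPast_of_eHomBesovNorm_bounded_of_albritton_analytic
    (hAl : albritton_besov_blowup) (hLA : lemarieRieusset2016_local_analyticity) :
    hasSmoothExtensionPast_of_eHomBesovNorm_bounded :=
  hasSmoothExtensionPast_of_eHomBesovNorm_bounded_of_gkp_analytic (gkp_besov_blowup_of_albritton hAl)
    hLA

-- `linter.deprecated` is switched off for the next declaration only: it names the deprecated
-- (mis-stated, 2026-08-15) tree-class rendering(s) of Albritton Thm. 1.1 (`albritton_besov_blowup`,
-- `CriticalRegularity.lean`), kept unchanged for their users until the faithful path-space forms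
-- are vendored (see those files).
set_option linter.deprecated false in
/-- **From Albritton's Thm. 1.1 and the KNSS local theory (L).** [cite: Albritton2018, Thm. 1.1] [cite: GKP2016, Thm. 1] -/
theorem hasSmoothExtensionPast_of_eHomBesovNorm_bounded_of_albritton_knssLocal
    (hAl : albritton_besov_blowup) (hL : knss2009_local_smoothing (EuclideanSpace ℝ (Fin 3))) :
    hasSmoothExtensionPast_of_eHomBesovNorm_bounded :=
  hasSmoothExtensionPast_of_eHomBesovNorm_bounded_of_gkp_knssLocal (gkp_besov_blowup_of_albritton hAl)
    hL

-- `linter.deprecated` is switched off for the next declaration only: it names the deprecated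
-- (mis-stated, 2026-08-15) tree-class rendering(s) of GKP Thm. 1 (`gkp_besov_blowup`,
-- `CriticalRegularity.lean`), kept unchanged for their users until the faithful path-space forms
-- are vendored (see those files).
set_option linter.deprecated false in
/-- **The route's dependency record, updated (2026-08-15):**
`hasSmoothExtensionPast_of_eHomBesovNorm_bounded` holds as soon as GKP's Thm. 1 and ONE of the two
local theories of the tree — (L) `knss2009_local_smoothing ℝ³` or
`lemarieRieusset2016_local_analyticity` — are discharged. [cite: GKP2016, Thm. 1] -/
theorem hasSmoothExtensionPast_of_eHomBesovNorm_bounded_of_gkp_local_or_analytic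
    (hG : gkp_besov_blowup)
    (hLoc : knss2009_local_smoothing (EuclideanSpace ℝ (Fin 3)) ∨
      lemarieRieusset2016_local_analyticity) :
    hasSmoothExtensionPast_of_eHomBesovNorm_bounded :=
  hLoc.elim (hasSmoothExtensionPast_of_eHomBesovNorm_bounded_of_gkp_knssLocal hG)
    (hasSmoothExtensionPast_of_eHomBesovNorm_bounded_of_gkp_analytic hG)

end Records

end Literature.Analysis.FluidPDE

end
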